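import Literature.Barriers.AnomalousDissipation.ShearFlowViscositySelectionLimit
import Literature.Analysis.FunctionSpaces.SpaceTimeWeakCompactness
import HarnessLib

/-!
# Bardos–Titi–Wiedemann 2012, Thm. 5 — proof architecture, part 3: the subsequential limit
assembled from the heat-flow limit and the limit equation

Third companion to `Literature/Barriers/AnomalousDissipation/ShearFlowViscositySelection.lean`
(Bardos–Titi–Wiedemann, C. R. Math. 350 (2012), Thm. 5). `ShearFlowViscositySelectionLimit`
reduced the theorem to the named facts `BardosTitiWiedemann2012_thm5_uniqueness` (part (ii))
and `BardosTitiWiedemann2012_thm5_subseqLimit` (the subsequential vanishing-viscosity limit).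
This file **proves** the latter from four finer inputs, following the printed proof sentence by
sentence:

1. the Leray–Hopf solutions are — up to null sets on every slice, by uniqueness — the
   two-and-a-half-dimensional ones `u^ν = (u₁^ν(x₂,t), 0, u₃^ν(x₁,x₂,t))`
   (`BardosTitiWiedemann2012_thm5_shearLerayHopf`, `BardosTitiWiedemann2012_thm5_uniqueness`,
   both in `ShearFlowViscositySelectionSteps`);
2. "the first equation is simply the one-dimensional heat equation with initial data `v₁(x₂)`,
   whose solution obviously converges to the time-independent function `v₁(x₂)` strongly in
   `L²(T×[0,T])`, as the viscosity tends to zero" — named fact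
   `BardosTitiWiedemann2012_thm5_heatLimit` (new);
3. "uniformly bounded in `L^∞_t L²_x`, there exists a subsequence `u^{ν_k}` which converges
   weak-* to `u ∈ L^∞_t L²_x`" — the **proved** weak-* sequential compactness
   `Torus.exists_strictMono_weakLimit_of_lintegral_sq_le` (`SpaceTimeWeakCompactness`), applied
   to the third components;
4. "`u` satisfies (6) … the equation for `u₃` follows from `u₁^ν u₃^ν ⇀* u₁u₃`, thanks to the
   strong convergence of `u₁^ν` to `u₁`. Next, it follows from Lemma 4 above that system (6) has a
   unique solution, and that this unique solution is given precisely by the shear flow (4) (see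
   [Bardos-Titi])" — named fact `BardosTitiWiedemann2012_thm5_limitEq` (new): the weak limit of
   the third components is the shear transport `v₃(x₁ - t v₁(x₂), x₂)`.

The assembly `BardosTitiWiedemann2012_thm5_subseqLimit_of_facts` is a real proof: the pairing
`∫₀ᵀ∫ ⟪u_j, ψ⟫` with a test field splits into `∫₀ᵀ∫ u₁ψ₁ + ∫₀ᵀ∫ u₃ψ₃` (second component zero),
the first converges by the strong `L²_{t,x}` convergence of `u₁^ν` (Cauchy–Schwarz in
`L²((0,T)×T³)`), the second by the weak convergence of `u₃^ν` to the identified limit.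

## This file

* `shearField a c` — the two-and-a-half-dimensional field `(a(t,x₂), 0, c(t,x₁,x₂))` on `T³`
  (the ansatz of the printed proof), with `shearField_apply`, `inner_shearField_left`,
  `shearFlow_eq_shearField`.
* `BardosTitiWiedemann2012_thm5_heatLimit`, `BardosTitiWiedemann2012_thm5_limitEq` — named
  facts (2) and (4) above.
* Proved glue on `L²((0,T)×T³)`: components of Leray–Hopf shear solutions and of test fields as
  square-integrable space–time functions, the pairing split, and the two limits.
* `BardosTitiWiedemann2012_thm5_subseqLimit_of_facts` — **proved**.

After this file, `BardosTitiWiedemann2012_thm5_holds` awaits the named facts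
`…_uniqueness`, `…_shearLerayHopf` (Steps), `…_heatLimit`, `…_limitEq` (here); the last rests
on `BardosTitiWiedemann2012_lemma4` (Limit) and the weak-solution property of the shear
transport.

## References

* C. Bardos, E. S. Titi, E. Wiedemann, C. R. Math. Acad. Sci. Paris 350 (2012) 757–760, Thm. 5,
  its proof, system (6), Lemma 4 (`BardosTitiWiedemann2012`).
* C. Bardos, E. S. Titi, Discrete Contin. Dyn. Syst. Ser. S 3 (2010), Thm. 2 (`BardosTiti2010`).
* H. Brezis, *Functional Analysis* (2011), Thm. 3.18, Cor. 3.30, Prop. 3.5 (iv) (weak–strong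
  pairing limits) (`Brezis2011`).
-/

open MeasureTheory Set Filter Topology Function
open scoped ENNReal NNReal InnerProductSpace RealInnerProductSpace

noncomputable section

namespace Literature.Barriers.AnomalousDissipation

/-- The flat three-torus `T³ = (ℝ/ℤ)³` (local notation). -/
local notation "𝕋³" => UnitAddTorus (Fin 3)
/-- The flat two-torus `T² = (ℝ/ℤ)²` (local notation). -/
local notation "𝕋²" => UnitAddTorus (Fin 2)
/-- Velocity values (local notation). -/
local notation "E³" => EuclideanSpace ℝ (Fin 3)

/-! ## Two-and-a-half-dimensional (shear-form) fields -/

/-- **The two-and-a-half-dimensional ansatz** `u(x,t) = (a(x₂,t), 0, c(x₁,x₂,t))` of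
Bardos–Titi–Wiedemann 2012, proof of Thm. 5 ("the intuition that the solution of Navier-Stokes
should preserve the particular structure of the initial data leads us to the ansatz
`u^ν(x,t) = (u^ν₁(x₂,t), 0, u^ν₃(x₁,x₂,t))`"), as a space–time field on `T³` built from
`a : ℝ → T → ℝ` and `c : ℝ → T² → ℝ` (time first; paper coordinates `x₁,x₂,x₃` ↦ indices
`0,1,2`). Literally the field of `BardosTitiWiedemann2012_thm5_shearLerayHopf`. [cite: BardosTitiWiedemann2012, Thm. 5, proof] -/
def shearField (a : ℝ → UnitAddCircle → ℝ) (c : ℝ → 𝕋² → ℝ) : ℝ → 𝕋³ → E³ :=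
  fun t x => !₂[a t (x 1), 0, c t ![x 0, x 1]]

/-- Components of the shear-form field: `u₁ = a(t,x₂)`, `u₂ = 0`, `u₃ = c(t,x₁,x₂)`. [folklore] -/
theorem shearField_apply (a : ℝ → UnitAddCircle → ℝ) (c : ℝ → 𝕋² → ℝ) (t : ℝ) (x : 𝕋³) :
    shearField a c t x 0 = a t (x 1) ∧ shearField a c t x 1 = 0 ∧
      shearField a c t x 2 = c t ![x 0, x 1] := by
  simp [shearField]

/-- Pairing a shear-form field with a vector: `⟪(a, 0, c), w⟫ = a w₁ + c w₃`. [folklore] -/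
theorem inner_shearField_left (a : ℝ → UnitAddCircle → ℝ) (c : ℝ → 𝕋² → ℝ) (t : ℝ) (x : 𝕋³)
    (w : E³) : ⟪shearField a c t x, w⟫ = a t (x 1) * w 0 + c t ![x 0, x 1] * w 2 := by
  simp [shearField, PiLp.inner_apply, Fin.sum_univ_three, mul_comm]

/-- **The shear flow is the shear-form field with `a = v₁` (constant in time) and `c` the shear
transport of `v₃`** (Bardos–Titi–Wiedemann 2012, (4) versus (6)). [cite: BardosTitiWiedemann2012, §2 (4)] -/
theorem shearFlow_eq_shearField (v₁ : UnitAddCircle → ℝ) (v₃ : 𝕋² → ℝ) :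
    shearFlow v₁ v₃ = shearField (fun _ => v₁) (shearTransport v₁ v₃) := by
  funext t x
  simp [shearFlow, shearField, shearTransport]

/-! ## The two remaining named facts of part (iii) -/

/-- **The heat-flow limit of the first component** (Bardos–Titi–Wiedemann 2012, proof of
Thm. 5), named fact. For shear data `v₀ = (v₁(x₂), 0, v₃(x₁,x₂))`, `v₁ ∈ L²(T)`, `v₃ ∈ L²(T²)`,
`T > 0`, viscosities `ν_j > 0` with `ν_j → 0`, and Leray–Hopf solutions on `T³ × [0,T)` of the
two-and-a-half-dimensional form `u_j = (a_j(t,x₂), 0, c_j(t,x₁,x₂))` with datum `v₀`, the first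
components converge to `v₁` strongly in `L²((0,T) × T³)`:
`∫₀ᵀ∫_{T³} |a_j(t,x₂) - v₁(x₂)|² dx dt → 0` — "the first equation is simply the
one-dimensional heat equation with initial data `v₁(x₂)`, whose solution obviously converges
to the time-independent function `v₁(x₂)` strongly in `L²(T×[0,T])`, as the viscosity tends to
zero" (op. cit.; the weak formulation tested with fields `(φ(t,x₂), 0, 0)` shows that `a_j` is a
weak solution of `∂ₜa = ν_j ∂²a`, `a(0) = v₁`, in `L^∞(0,T;L²(T))`, i.e. the heat flow
`â_j(k,t) = e^{-4π²k²ν_j t} v̂₁(k)`, and `∑_k |v̂₁(k)|² (1 - e^{-4π²k²ν_j T})² → 0`). The integral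
over `T³` of a function of `x₂` is its integral over `T`. [cite: BardosTitiWiedemann2012, Thm. 5, proof] -/
def BardosTitiWiedemann2012_thm5_heatLimit : Prop :=
  ∀ (v₁ : UnitAddCircle → ℝ) (_hv₁ : MemLp v₁ 2 volume) (v₃ : 𝕋² → ℝ) (_hv₃ : MemLp v₃ 2 volume)
    (T : ℝ) (_hT : 0 < T) (ν : ℕ → ℝ) (_hν : ∀ j, 0 < ν j) (_hν₀ : Tendsto ν atTop (𝓝 0))
    (a : ℕ → ℝ → UnitAddCircle → ℝ) (c : ℕ → ℝ → 𝕋² → ℝ)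
    (_hU : ∀ j, Literature.Analysis.FluidPDE.Torus.IsLerayHopfOn T (ν j) 0 (shearData v₁ v₃)
      (shearField (a j) (c j))),
    Tendsto (fun j => ∫⁻ t in Ioo 0 T, ∫⁻ x : 𝕋³, ‖a j t (x 1) - v₁ (x 1)‖ₑ ^ 2) atTop (𝓝 0)

/-- **The limit equation and its unique solution** (Bardos–Titi–Wiedemann 2012, proof of Thm. 5,
system (6) with Lemma 4; Bardos–Titi 2010, Thm. 2), named fact packaging the two printed
sentences "`u` satisfies (6) [`u₁ = v₁`, `u₂ = 0`, `∂ₜu₃ + v₁(x₂)∂_{x₁}u₃ = 0`, `u₃(0) = v₃`].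
Indeed, the equation for `u₃` follows from `u₁^ν u₃^ν ⇀* u₁u₃`, thanks to the strong convergence
of `u₁^ν` to `u₁`. Next, it follows from Lemma 4 above that system (6) has a unique solution,
and that this unique solution is given precisely by the shear flow (4) (see [Bardos-Titi])."
Precisely: let `u_j = (a_j(t,x₂), 0, c_j(t,x₁,x₂))` be Leray–Hopf solutions on `T³ × [0,T)`
with shear datum `v₀` and viscosities `ν_j > 0`, `ν_j → 0`, whose first components converge to
`v₁` in `L²((0,T)×T³)` and whose third components converge weakly in `L²((0,T)×T³)` — against
every square-integrable space–time function with measurable lift — to a field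
`W ∈ L^∞(0,T;L²(T³))` with measurable space–time lift. Then `W` is the third component of the
shear flow: `W(t,x) = v₃(x₁ - t v₁(x₂), x₂)` for a.e. `x`, for a.e. `t ∈ (0,T)`. (Discharge
route: the weak formulation tested with `(0,0,φ)`, `∂₃φ = 0`, exhibits `c_j` as a weak solution
of `∂ₜc + a_j∂₁c = ν_jΔc`; passing to the limit gives a weak solution, invariant along `x₃`, of
the transport equation of `BardosTitiWiedemann2012_lemma4`, whose unique solution is
`shearTransport v₁ v₃`.) [cite: BardosTitiWiedemann2012, Thm. 5, proof] -/
def BardosTitiWiedemann2012_thm5_limitEq : Prop :=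
  ∀ (v₁ : UnitAddCircle → ℝ) (_hv₁ : MemLp v₁ 2 volume) (v₃ : 𝕋² → ℝ) (_hv₃ : MemLp v₃ 2 volume)
    (T : ℝ) (_hT : 0 < T) (ν : ℕ → ℝ) (_hν : ∀ j, 0 < ν j) (_hν₀ : Tendsto ν atTop (𝓝 0))
    (a : ℕ → ℝ → UnitAddCircle → ℝ) (c : ℕ → ℝ → 𝕋² → ℝ)
    (_hU : ∀ j, Literature.Analysis.FluidPDE.Torus.IsLerayHopfOn T (ν j) 0 (shearData v₁ v₃)
      (shearField (a j) (c j)))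
    (W : ℝ → 𝕋³ → ℝ)
    (_hWm : AEStronglyMeasurable (Literature.Analysis.FunctionSpaces.Torus.stLift W)
      (volume.restrict (Ioo 0 T ×ˢ univ)))
    (_hWb : ∃ C : ℝ≥0, ∀ᵐ t ∂(volume.restrict (Ioo 0 T)), ∫⁻ x, ‖W t x‖ₑ ^ 2 ≤ C)
    (_hheat : Tendsto (fun j => ∫⁻ t in Ioo 0 T, ∫⁻ x : 𝕋³, ‖a j t (x 1) - v₁ (x 1)‖ₑ ^ 2)
      atTop (𝓝 0))
    (_hweak : ∀ G : ℝ → 𝕋³ → ℝ,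
      AEStronglyMeasurable (Literature.Analysis.FunctionSpaces.Torus.stLift G)
        (volume.restrict (Ioo 0 T ×ˢ univ)) →
      ∫⁻ t in Ioo 0 T, ∫⁻ x, ‖G t x‖ₑ ^ 2 < ∞ →
      Tendsto (fun j => ∫ t in Ioo 0 T, ∫ x, c j t ![x 0, x 1] * G t x) atTop
        (𝓝 (∫ t in Ioo 0 T, ∫ x, W t x * G t x))),
    ∀ᵐ t ∂(volume.restrict (Ioo 0 T)), W t =ᵐ[volume] fun x => shearTransport v₁ v₃ t ![x 0, x 1]

/-! ## Square-integrable space–time functions on `(0,T) × T³`: glue -/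

section Glue

variable {T : ℝ}

/-- Space–time measurability of a component of a vector field with measurable lift. [folklore] -/
theorem aestronglyMeasurable_stLift_apply {u : ℝ → 𝕋³ → E³} {S : Set ℝ}
    (hu : AEStronglyMeasurable (Literature.Analysis.FunctionSpaces.Torus.stLift u)
      (volume.restrict (S ×ˢ univ))) (i : Fin 3) :
    AEStronglyMeasurable (Literature.Analysis.FunctionSpaces.Torus.stLift fun t x => u t x i)
      (volume.restrict (S ×ˢ univ)) :=
  (EuclideanSpace.proj i).continuous.comp_aestronglyMeasurable hu

/-- **A component of a test field is a square-integrable space–time function**: for a smooth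
space–time test field `ψ` and `i`, the scalar `(t,x) ↦ ψ(t,x)ᵢ` has measurable lift on
`(0,T) × ℝ³`, finite `∫₀ᵀ∫ |ψᵢ|²`, and lies in `L²((vol|_(0,T)) ⊗ vol)`. [folklore] -/
theorem test_component_memLp {ψ : ℝ → 𝕋³ → E³}
    (hψ : Literature.Analysis.FunctionSpaces.Torus.IsSpaceTimeTestIoo T ψ) (i : Fin 3) :
    AEStronglyMeasurable (Literature.Analysis.FunctionSpaces.Torus.stLift fun t x => ψ t x i)
        (volume.restrict (Ioo 0 T ×ˢ univ)) ∧
      ∫⁻ t in Ioo 0 T, ∫⁻ x, ‖ψ t x i‖ₑ ^ 2 < ∞ ∧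
      MemLp (uncurry fun t x => ψ t x i) 2
        (((volume : Measure ℝ).restrict (Ioo 0 T)).prod (volume : Measure 𝕋³)) := by
  have hcont : Continuous (Literature.Analysis.FunctionSpaces.Torus.stLift ψ) := hψ.1.1.continuous
  have hm : AEStronglyMeasurable (Literature.Analysis.FunctionSpaces.Torus.stLift fun t x => ψ t x i)
      (volume.restrict (Ioo 0 T ×ˢ univ)) :=
    ((EuclideanSpace.proj i).continuous.comp hcont).aestronglyMeasurable
  obtain ⟨K, hK⟩ := Literature.Analysis.FunctionSpaces.Torus.exists_norm_le_of_continuousOn_of_isCompact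
    (S := univ) hcont.continuousOn isCompact_Icc (subset_univ (Icc (0 : ℝ) T))
  have hKi : ∀ t ∈ Icc (0 : ℝ) T, ∀ x, ‖ψ t x i‖ ≤ K := fun t ht x =>
    (PiLp.norm_apply_le (ψ t x) i).trans (hK t ht x)
  have hfin : ∫⁻ t in Ioo 0 T, ∫⁻ x, ‖ψ t x i‖ₑ ^ 2 < ∞ := by
    have hslice : ∀ t ∈ Ioo (0 : ℝ) T, ∫⁻ x, ‖ψ t x i‖ₑ ^ 2 ≤ ENNReal.ofReal (K ^ 2) := by
      intro t ht
      calc ∫⁻ x, ‖ψ t x i‖ₑ ^ 2 ≤ ∫⁻ _ : 𝕋³, ENNReal.ofReal (K ^ 2) := by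
            refine lintegral_mono fun x => ?_
            rw [← ofReal_norm, ← ENNReal.ofReal_pow (norm_nonneg _)]
            exact ENNReal.ofReal_le_ofReal (pow_le_pow_left₀ (norm_nonneg _)
              (hKi t (Ioo_subset_Icc_self ht) x) 2)
        _ = ENNReal.ofReal (K ^ 2) := by rw [lintegral_const, measure_univ, mul_one]
    calc ∫⁻ t in Ioo 0 T, ∫⁻ x, ‖ψ t x i‖ₑ ^ 2 ≤ ∫⁻ _ in Ioo (0 : ℝ) T, ENNReal.ofReal (K ^ 2) :=
          setLIntegral_mono measurable_const hslice
      _ < ∞ := by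
          rw [lintegral_const, Measure.restrict_apply_univ]
          exact ENNReal.mul_lt_top ENNReal.ofReal_lt_top measure_Ioo_lt_top
  exact ⟨hm, hfin, (Literature.Analysis.FunctionSpaces.Torus.memLp_two_uncurry
    (Literature.Analysis.FunctionSpaces.Torus.aestronglyMeasurable_uncurry_of_stLift_prod hm) hfin).1⟩

/-- **Components of an unforced Leray–Hopf solution are square-integrable space–time
functions**: for a Leray–Hopf solution `u` on `T³ × [0,T)` with datum `u₀ ∈ L²`, `ν ≥ 0`, and
a component `i`, the scalar `uᵢ` has measurable lift on `(0,T) × ℝ³`, slices with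
`∫ |uᵢ(t)|² ≤ ∫ |u₀|²` for all `t ∈ [0,T]` (energy inequality), finite `∫₀ᵀ∫ |uᵢ|²`, and lies
in `L²((vol|_(0,T)) ⊗ vol)`. [folklore] -/
theorem lerayHopf_component_memLp {ν : ℝ} (hν : 0 ≤ ν) {u₀ : 𝕋³ → E³} (hu₀ : MemLp u₀ 2 volume)
    {u : ℝ → 𝕋³ → E³} (hu : Literature.Analysis.FluidPDE.Torus.IsLerayHopfOn T ν 0 u₀ u)
    (i : Fin 3) :
    AEStronglyMeasurable (Literature.Analysis.FunctionSpaces.Torus.stLift fun t x => u t x i)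
        (volume.restrict (Ioo 0 T ×ˢ univ)) ∧
      (∀ t ∈ Icc 0 T, ∫⁻ x, ‖u t x i‖ₑ ^ 2 ≤ ∫⁻ x, ‖u₀ x‖ₑ ^ 2) ∧
      ∫⁻ t in Ioo 0 T, ∫⁻ x, ‖u t x i‖ₑ ^ 2 < ∞ ∧
      MemLp (uncurry fun t x => u t x i) 2
        (((volume : Measure ℝ).restrict (Ioo 0 T)).prod (volume : Measure 𝕋³)) := by
  have hm := aestronglyMeasurable_stLift_apply hu.weak.1 i
  have hslice : ∀ t ∈ Icc 0 T, ∫⁻ x, ‖u t x i‖ₑ ^ 2 ≤ ∫⁻ x, ‖u₀ x‖ₑ ^ 2 := fun t ht =>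
    (lintegral_mono fun x => pow_le_pow_left' (PiLp.enorm_apply_le (u t x) i) 2).trans
      (lintegral_enorm_sq_le_of_isLerayHopfOn hν hu hu₀ ht)
  have hfin0 : ∫⁻ x, ‖u₀ x‖ₑ ^ 2 < ∞ := by
    rw [lintegral_enorm_sq_eq_ofReal_kineticEnergy hu₀]; exact ENNReal.ofReal_lt_top
  have hfin : ∫⁻ t in Ioo 0 T, ∫⁻ x, ‖u t x i‖ₑ ^ 2 < ∞ := by
    calc ∫⁻ t in Ioo 0 T, ∫⁻ x, ‖u t x i‖ₑ ^ 2 ≤ ∫⁻ _ in Ioo (0 : ℝ) T, ∫⁻ x, ‖u₀ x‖ₑ ^ 2 :=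
          setLIntegral_mono measurable_const fun t ht => hslice t (Ioo_subset_Icc_self ht)
      _ < ∞ := by
          rw [lintegral_const, Measure.restrict_apply_univ]
          exact ENNReal.mul_lt_top hfin0 measure_Ioo_lt_top
  exact ⟨hm, hslice, hfin, (Literature.Analysis.FunctionSpaces.Torus.memLp_two_uncurry
    (Literature.Analysis.FunctionSpaces.Torus.aestronglyMeasurable_uncurry_of_stLift_prod hm) hfin).1⟩

/-- **A function of `x₂` alone, square integrable on `T`, is a square-integrable space–time
function on `(0,T) × T³`** (constant in `t`, `x₁`, `x₃`): `(t,x) ↦ v(x₂)` lies in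
`L²((vol|_(0,T)) ⊗ vol)`. [folklore] -/
theorem memLp_uncurry_const_eval_one {v : UnitAddCircle → ℝ} (hv : MemLp v 2 volume) :
    MemLp (uncurry fun (_ : ℝ) (x : 𝕋³) => v (x 1)) 2
      (((volume : Measure ℝ).restrict (Ioo 0 T)).prod (volume : Measure 𝕋³)) := by
  have h3 : MemLp (fun x : 𝕋³ => v (x 1)) 2 volume :=
    hv.comp_measurePreserving measurePreserving_eval_one
  exact h3.comp_snd ((volume : Measure ℝ).restrict (Ioo 0 T))

/-- **The iterated pairing of two square-integrable space–time functions splits additively**: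
`∫₀ᵀ∫ (f₁g₁ + f₂g₂) = ∫₀ᵀ∫ f₁g₁ + ∫₀ᵀ∫ f₂g₂` for `fᵢ, gᵢ ∈ L²((vol|_(0,T)) ⊗ vol)` (through
the product integral, Fubini). [folklore] -/
theorem setIntegral_integral_add_mul {f₁ g₁ f₂ g₂ : ℝ → 𝕋³ → ℝ}
    (hf₁ : MemLp (uncurry f₁) 2 (((volume : Measure ℝ).restrict (Ioo 0 T)).prod (volume : Measure 𝕋³)))
    (hg₁ : MemLp (uncurry g₁) 2 (((volume : Measure ℝ).restrict (Ioo 0 T)).prod (volume : Measure 𝕋³)))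
    (hf₂ : MemLp (uncurry f₂) 2 (((volume : Measure ℝ).restrict (Ioo 0 T)).prod (volume : Measure 𝕋³)))
    (hg₂ : MemLp (uncurry g₂) 2 (((volume : Measure ℝ).restrict (Ioo 0 T)).prod (volume : Measure 𝕋³))) :
    ∫ t in Ioo 0 T, ∫ x, (f₁ t x * g₁ t x + f₂ t x * g₂ t x) =
      (∫ t in Ioo 0 T, ∫ x, f₁ t x * g₁ t x) + ∫ t in Ioo 0 T, ∫ x, f₂ t x * g₂ t x := by
  have h1 : Integrable (uncurry fun t x => f₁ t x * g₁ t x)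
      (((volume : Measure ℝ).restrict (Ioo 0 T)).prod (volume : Measure 𝕋³)) := hf₁.integrable_mul hg₁
  have h2 : Integrable (uncurry fun t x => f₂ t x * g₂ t x)
      (((volume : Measure ℝ).restrict (Ioo 0 T)).prod (volume : Measure 𝕋³)) := hf₂.integrable_mul hg₂
  exact integral_integral_add h1 h2

/-- **Strong `L²_{t,x}` convergence passes through the pairing with a fixed square-integrable
function** (Cauchy–Schwarz in `L²((vol|_(0,T)) ⊗ vol)`; Brezis 2011, Prop. 3.5 (iv)): if
`∫₀ᵀ∫ |f_j - f|² → 0` then `∫₀ᵀ∫ f_j g → ∫₀ᵀ∫ f g`. [cite: Brezis2011, Prop. 3.5 (iv)] -/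
theorem tendsto_setIntegral_integral_mul_of_tendsto_lintegral {f : ℕ → ℝ → 𝕋³ → ℝ}
    {f₀ g : ℝ → 𝕋³ → ℝ}
    (hf : ∀ j, MemLp (uncurry (f j)) 2 (((volume : Measure ℝ).restrict (Ioo 0 T)).prod (volume : Measure 𝕋³)))
    (hf₀ : MemLp (uncurry f₀) 2 (((volume : Measure ℝ).restrict (Ioo 0 T)).prod (volume : Measure 𝕋³)))
    (hg : MemLp (uncurry g) 2 (((volume : Measure ℝ).restrict (Ioo 0 T)).prod (volume : Measure 𝕋³)))
    (hlim : Tendsto (fun j => ∫⁻ t in Ioo 0 T, ∫⁻ x, ‖f j t x - f₀ t x‖ₑ ^ 2) atTop (𝓝 0)) :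
    Tendsto (fun j => ∫ t in Ioo 0 T, ∫ x, f j t x * g t x) atTop
      (𝓝 (∫ t in Ioo 0 T, ∫ x, f₀ t x * g t x)) := by
  have hdiff : ∀ j, MemLp (uncurry (f j) - uncurry f₀) 2
      (((volume : Measure ℝ).restrict (Ioo 0 T)).prod (volume : Measure 𝕋³)) := fun j => (hf j).sub hf₀
  have hsq : ∀ j, eLpNorm (uncurry (f j) - uncurry f₀) 2
      (((volume : Measure ℝ).restrict (Ioo 0 T)).prod (volume : Measure 𝕋³)) ^ 2 =
      ∫⁻ t in Ioo 0 T, ∫⁻ x, ‖f j t x - f₀ t x‖ₑ ^ 2 := by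
    intro j
    rw [Literature.Analysis.FunctionSpaces.eLpNorm_two_pow_two_eq_lintegral,
      lintegral_prod _ ((hdiff j).1.aemeasurable.enorm.pow_const 2)]
    rfl
  -- `toLp f_j → toLp f₀` in `L²`
  have hnorm : ∀ j, ‖(hf j).toLp _ - hf₀.toLp _‖ =
      ((∫⁻ t in Ioo 0 T, ∫⁻ x, ‖f j t x - f₀ t x‖ₑ ^ 2) ^ (1 / 2 : ℝ)).toReal := by
    intro j
    rw [← MemLp.toLp_sub, Lp.norm_toLp,
      Literature.Analysis.FunctionSpaces.eLpNorm_two_eq_pow_two_rpow_half, hsq]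
  have h1 : Tendsto (fun j => (∫⁻ t in Ioo 0 T, ∫⁻ x, ‖f j t x - f₀ t x‖ₑ ^ 2) ^ (1 / 2 : ℝ))
      atTop (𝓝 0) := by
    have h0 : (0 : ℝ≥0∞) ^ (1 / 2 : ℝ) = 0 := ENNReal.zero_rpow_of_pos (by norm_num)
    rw [← h0]
    exact ((ENNReal.continuous_rpow_const (y := (1 / 2 : ℝ))).tendsto 0).comp hlim
  have h2 : Tendsto (fun j => ‖(hf j).toLp _ - hf₀.toLp _‖) atTop (𝓝 0) := by
    have := (ENNReal.tendsto_toReal ENNReal.zero_ne_top).comp h1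
    rw [ENNReal.toReal_zero] at this
    refine this.congr fun j => ?_
    rw [hnorm j]
    rfl
  have hL : Tendsto (fun j => (hf j).toLp _) atTop (𝓝 (hf₀.toLp _)) :=
    tendsto_iff_norm_sub_tendsto_zero.2 h2
  have := Filter.Tendsto.inner (𝕜 := ℝ) hL (tendsto_const_nhds (x := hg.toLp (uncurry g)))
  simp_rw [Literature.Analysis.FunctionSpaces.Torus.inner_toLp_uncurry_eq] at this
  exact this

end Glue

/-! ## The subsequential limit from the four facts -/

/-- **Bardos–Titi–Wiedemann 2012, Thm. 5, part (iii), subsequential form — proved from the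
structure, uniqueness, heat-limit and limit-equation facts.** Given `v₁ ∈ L²(T)`,
`v₃ ∈ L²(T²)`, `T > 0`, `ν_j > 0`, `ν_j → 0` and Leray–Hopf solutions `u_j` with shear datum:
(1) by `BardosTitiWiedemann2012_thm5_uniqueness.ae_eq_shear` each `u_j` agrees a.e. on every
slice `t ∈ (0,T]` with a Leray–Hopf solution `(a_j(t,x₂), 0, c_j(t,x₁,x₂))`; (2) the third
components are bounded in `L^∞_t L²_x` by the initial energy, so a subsequence converges weakly
in `L²((0,T)×T³)` to some `W ∈ L^∞_t L²_x` (`Torus.exists_strictMono_weakLimit_of_lintegral_sq_le`,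
proved); (3) the first components converge to `v₁` in `L²_{t,x}` (`…_heatLimit`); (4) `W` is
the shear transport of `v₃` (`…_limitEq`); (5) for a test field `ψ`,
`∫₀ᵀ∫ ⟪u_j, ψ⟫ = ∫₀ᵀ∫ a_jψ₁ + ∫₀ᵀ∫ c_jψ₃ → ∫₀ᵀ∫ v₁ψ₁ + ∫₀ᵀ∫ Wψ₃ = ∫₀ᵀ∫ ⟪v, ψ⟫` along the
subsequence (strong, resp. weak, convergence), and the `L^∞_t L²_x` bound is the energy
inequality. [cite: BardosTitiWiedemann2012, Thm. 5, proof] -/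
theorem BardosTitiWiedemann2012_thm5_subseqLimit_of_facts
    (hshear : BardosTitiWiedemann2012_thm5_shearLerayHopf)
    (huniq : BardosTitiWiedemann2012_thm5_uniqueness)
    (hheat : BardosTitiWiedemann2012_thm5_heatLimit)
    (hlimEq : BardosTitiWiedemann2012_thm5_limitEq) :
    BardosTitiWiedemann2012_thm5_subseqLimit := by
  intro v₁ hv₁ v₃ hv₃ T hT ν hν hν₀ u hu
  have hmem : MemLp (shearData v₁ v₃) 2 volume := memLp_shearData hv₁ hv₃
  -- (1) the shear-form representatives
  have hrep := fun j =>
    BardosTitiWiedemann2012_thm5_uniqueness.ae_eq_shear huniq hshear hv₁ hv₃ hT (hν j) (hu j)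
  choose a c hU hae using hrep
  have hU' : ∀ j, Literature.Analysis.FluidPDE.Torus.IsLerayHopfOn T (ν j) 0 (shearData v₁ v₃)
      (shearField (a j) (c j)) := hU
  -- components as square-integrable space–time functions
  have hA := fun j => lerayHopf_component_memLp (hν j).le hmem (hU' j) 0
  have hC := fun j => lerayHopf_component_memLp (hν j).le hmem (hU' j) 2
  have hA_eq : ∀ j t (x : 𝕋³), shearField (a j) (c j) t x 0 = a j t (x 1) := fun j t x =>
    (shearField_apply _ _ t x).1
  have hC_eq : ∀ j t (x : 𝕋³), shearField (a j) (c j) t x 2 = c j t ![x 0, x 1] := fun j t x =>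
    (shearField_apply _ _ t x).2.2
  -- (2) weak-* compactness of the third components
  set Cb : ℝ≥0 := (2 * Literature.Analysis.FunctionSpaces.Torus.kineticEnergy (shearData v₁ v₃)).toNNReal
    with hCb
  have hCb_eq : ∫⁻ x, ‖shearData v₁ v₃ x‖ₑ ^ 2 = Cb := by
    rw [lintegral_enorm_sq_eq_ofReal_kineticEnergy hmem]; rfl
  have hCm : ∀ j, AEStronglyMeasurable
      (Literature.Analysis.FunctionSpaces.Torus.stLift fun t (x : 𝕋³) => c j t ![x 0, x 1])
      (volume.restrict (Ioo 0 T ×ˢ univ)) := by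
    intro j
    have h := (hC j).1
    simp_rw [hC_eq] at h
    exact h
  have hCb' : ∀ j, ∀ᵐ t ∂(volume.restrict (Ioo 0 T)), ∫⁻ x : 𝕋³, ‖c j t ![x 0, x 1]‖ₑ ^ 2 ≤ Cb := by
    intro j
    refine (ae_restrict_mem measurableSet_Ioo).mono fun t ht => ?_
    have h := (hC j).2.1 t (Ioo_subset_Icc_self ht)
    simp_rw [hC_eq] at h
    exact h.trans_eq hCb_eq
  obtain ⟨φ, hφ, W, hWm, hWb, hWweak⟩ :=
    Literature.Analysis.FunctionSpaces.Torus.exists_strictMono_weakLimit_of_lintegral_sq_le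
      (θ := fun j t (x : 𝕋³) => c j t ![x 0, x 1]) hCm hCb'
  -- (3) the heat-flow limit, along the subsequence
  have hheatφ : Tendsto (fun k => ∫⁻ t in Ioo 0 T, ∫⁻ x : 𝕋³, ‖a (φ k) t (x 1) - v₁ (x 1)‖ₑ ^ 2)
      atTop (𝓝 0) :=
    (hheat v₁ hv₁ v₃ hv₃ T hT ν hν hν₀ a c hU').comp hφ.tendsto_atTop
  -- (4) identification of the limit
  have hWeq : ∀ᵐ t ∂(volume.restrict (Ioo 0 T)),
      W t =ᵐ[volume] fun x => shearTransport v₁ v₃ t ![x 0, x 1] :=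
    hlimEq v₁ hv₁ v₃ hv₃ T hT (ν ∘ φ) (fun k => hν (φ k)) (hν₀.comp hφ.tendsto_atTop)
      (a ∘ φ) (c ∘ φ) (fun k => hU' (φ k)) W hWm ⟨Cb, hWb⟩ hheatφ hWweak
  -- (5) weak-* convergence of `u ∘ φ`
  refine ⟨φ, hφ, ?_, fun ψ hψ => ?_⟩
  · refine ⟨Cb, fun m => (ae_restrict_mem measurableSet_Ioo).mono fun t ht => ?_⟩
    exact (lintegral_enorm_sq_le_of_isLerayHopfOn (hν (φ m)).le (hu (φ m)) hmem
      (Ioo_subset_Icc_self ht)).trans_eq hCb_eq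
  · -- the test components
    have hG0 := test_component_memLp hψ 0
    have hG2 := test_component_memLp hψ 2
    -- replace `u` by its shear representative inside the pairing
    have hpair : ∀ j, ∫ t in Ioo 0 T, ∫ x, ⟪u j t x, ψ t x⟫ =
        (∫ t in Ioo 0 T, ∫ x : 𝕋³, a j t (x 1) * ψ t x 0) +
          ∫ t in Ioo 0 T, ∫ x : 𝕋³, c j t ![x 0, x 1] * ψ t x 2 := by
      intro j
      have h1 : ∫ t in Ioo 0 T, ∫ x, ⟪u j t x, ψ t x⟫ =
          ∫ t in Ioo 0 T, ∫ x, ⟪shearField (a j) (c j) t x, ψ t x⟫ := by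
        refine setIntegral_congr_fun measurableSet_Ioo fun t ht => ?_
        exact integral_congr_ae ((hae j t ⟨ht.1, ht.2.le⟩).mono fun x hx => by
          simp only [hx, shearField])
      rw [h1]
      simp_rw [inner_shearField_left]
      have hA' : MemLp (uncurry fun t (x : 𝕋³) => a j t (x 1)) 2
          (((volume : Measure ℝ).restrict (Ioo 0 T)).prod (volume : Measure 𝕋³)) := by
        have h := (hA j).2.2.2; simp_rw [hA_eq] at h; exact h
      have hC' : MemLp (uncurry fun t (x : 𝕋³) => c j t ![x 0, x 1]) 2
          (((volume : Measure ℝ).restrict (Ioo 0 T)).prod (volume : Measure 𝕋³)) := by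
        have h := (hC j).2.2.2; simp_rw [hC_eq] at h; exact h
      exact setIntegral_integral_add_mul hA' hG0.2.2 hC' hG2.2.2
    have hWfin : ∫⁻ t in Ioo 0 T, ∫⁻ x, ‖W t x‖ₑ ^ 2 < ∞ := by
      refine (lintegral_mono_ae hWb).trans_lt ?_
      rw [lintegral_const, Measure.restrict_apply_univ]
      exact ENNReal.mul_lt_top ENNReal.coe_lt_top measure_Ioo_lt_top
    have hWL : MemLp (uncurry W) 2
        (((volume : Measure ℝ).restrict (Ioo 0 T)).prod (volume : Measure 𝕋³)) :=
      (Literature.Analysis.FunctionSpaces.Torus.memLp_two_uncurry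
        (Literature.Analysis.FunctionSpaces.Torus.aestronglyMeasurable_uncurry_of_stLift_prod hWm)
        hWfin).1
    have hlimit_pair : ∫ t in Ioo 0 T, ∫ x, ⟪shearFlow v₁ v₃ t x, ψ t x⟫ =
        (∫ t in Ioo 0 T, ∫ x : 𝕋³, v₁ (x 1) * ψ t x 0) +
          ∫ t in Ioo 0 T, ∫ x : 𝕋³, W t x * ψ t x 2 := by
      rw [shearFlow_eq_shearField]
      simp_rw [inner_shearField_left]
      have hcongr : ∫ t in Ioo 0 T, ∫ x : 𝕋³,
          (v₁ (x 1) * ψ t x 0 + shearTransport v₁ v₃ t ![x 0, x 1] * ψ t x 2) =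
          ∫ t in Ioo 0 T, ∫ x : 𝕋³, (v₁ (x 1) * ψ t x 0 + W t x * ψ t x 2) :=
        integral_congr_ae (hWeq.mono fun t ht =>
          integral_congr_ae (ht.mono fun x hx => by simp only [hx]))
      rw [hcongr]
      exact setIntegral_integral_add_mul (memLp_uncurry_const_eval_one hv₁) hG0.2.2 hWL hG2.2.2
    rw [hlimit_pair]
    simp_rw [Function.comp_apply, hpair]
    refine Tendsto.add ?_ ?_
    · -- first components: strong convergence
      have hA' : ∀ k, MemLp (uncurry fun t (x : 𝕋³) => a (φ k) t (x 1)) 2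
          (((volume : Measure ℝ).restrict (Ioo 0 T)).prod (volume : Measure 𝕋³)) := by
        intro k; have h := (hA (φ k)).2.2.2; simp_rw [hA_eq] at h; exact h
      exact tendsto_setIntegral_integral_mul_of_tendsto_lintegral hA'
        (memLp_uncurry_const_eval_one hv₁) hG0.2.2 hheatφ
    · -- third components: weak convergence to the limit `W`
      exact hWweak (fun t x => ψ t x 2) hG2.1 hG2.2.1

end Literature.Barriers.AnomalousDissipation

end
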